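import Literature.Computability.AlgebraicComplexity.RectangularExponentCert
import Literature.Computability.AlgebraicComplexity.RectangularExponentLaserCertificate
import Literature.Computability.AlgebraicComplexity.LaserDegenerationBound
import Literature.Barriers.MatrixMultiplication.RectangularBarrier
import HarnessLib

/-!
# The certificate-backed 2024 table: reduction to a laser-method degeneration certificate — proved

Topic `Literature/Computability/AlgebraicComplexity`; companion of `RectangularExponentCert.lean`
(the named fact `vxxz2024_omegaRect_table_certified`: `ω(1, κ, 1) ≤ b` for the 24 rows of
`vxxz2024TableCertified`, Table 1 of Vassilevska Williams–Xu–Xu–Zhou, SODA 2024, with three entries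
replaced by the round-up of the objective stored in the authors' published SNOPT parameter files,
osf.io/7wgh2), of `RectangularExponentLaserCertificate.lean` (the table-indexed predicate
`CW5DegenerationCertificate` and the PROVED passage from such a certificate to the bounds,
`omegaRect_le_of_cw5DegenerationCertificate`, written for the 2025 table) and of
`LaserDegenerationBound.lean` (the square assembly `omega_le_of_forall_polyDegeneratesTo`: from
degenerations `⟨M⟩ ⊗ CW_q^{⊗N} ⊵ ⟨t⟩ ⊗ ⟨m, m, m⟩` with `M (q+2)^N ≤ t · m^{w+δ}` for every `δ > 0` to
`ω ≤ w`, proved).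

The printed proof of a row `ω(1, κ, 1) ≤ ω'` (VXXZ 2024, §4.1 "Algorithm Framework" and §8, first
paragraph) has the layers

1. `R̃(CW_q) ≤ q + 2` (§3.6) — proved in the tree (`asymptoticRank_bigCwTensor_le`);
2. Schönhage's asymptotic sum inequality for `ω(1, κ, 1)` (Thm. 3.2) — proved in the tree
   (`mul_rpow_omegaRect_mid_le_asymptoticRank`);
3. (T) the paper's laser method: Thm. 5.3 (global stage), Thm. 6.1 (matrix-multiplication terms),
   Thm. 6.3 (constituent stage, levels `ℓ*, …, 2`), Cor. 4.2 (fixing holes in interface tensors;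
   arXiv numbering — the corollary stated after Def. 4.1 and proved from Thm. 7.2 in §7; the
   companion `RectangularExponentLaserCertificate.lean` cites the same statement as "Cor. 3.2",
   to be harmonised), which DEGENERATE `2^{o(n)}` independent copies of `CW_q^{⊗ 2^{ℓ*-1} n}` into
   independent copies of `⟨a, a^κ, a⟩` (§4: "degenerates it into a collection of independent matrix
   multiplication tensors of the same size `⟨m, m^K, m⟩`. By the asymptotic sum inequality
   (Thm. 3.2), this will give an upper bound on `ω(1, K, 1)`");
4. (C) a parameter vector satisfying "all constraints in Thms. 5.3, 6.1, 6.3" and the limiting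
   condition `lim_{ε→0} lim_{n→∞} numgrow^{1/n} · min{A, B^{1/κ}, C}^{ω'/n} ≥ (q+2)^{2^{ℓ*-1}}`
   (§8, the displayed optimisation problem "minimize `ω'` subject to …"), found by SQP (SNOPT) for
   `ℓ* = 3`, `q = 5` and published at osf.io/7wgh2.

Layers 3–4 together say exactly that `CW5DegenerationCertificate vxxz2024TableCertified` holds (for
every row `(κ, b)` and `δ > 0`, `t` copies of some `CW_5^{⊗N}` degenerate into `V` copies of
`⟨a, B, a⟩`, `B ≥ a^κ`, with `t · 7^N ≤ V · a^{b+δ}`).  This file does NOT vendor that statement as a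
further named fact (D-0026: the proving seat of `vxxz2024_omegaRect_table_certified` may not grow the
debt); it takes it as an explicit hypothesis and PROVES

* `vxxz2024_omegaRect_table_certified_of_cw5Certificate` — it implies
  `vxxz2024_omegaRect_table_certified` (layers 1–2 are theorems of the tree);
* `CW5DegenerationCertificate.mono` — a certificate for a table certifies every table with the same
  exponents `κ` and bounds `≥` its bounds (`a ≥ 2`, so `a^{b+δ}` is monotone in `b`);
* `cw5Certificate_vxxz2024TableCertified_of_printed` — hence a certificate for the PRINTED Table 1
  (`CW5DegenerationCertificate vxxz2024Table`, the natural trust base of `vxxz2024_omegaRect_table`,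
  which it implies: `vxxz2024_omegaRect_table_of_cw5Certificate`) implies the one for the
  certificate-backed table: every certified bound is `≥` the printed one
  (`vxxz2024Table_row_le_certified`; they differ at `κ = 0.321334, 0.70, 1.20` only);
* `forall_polyDegeneratesTo_square_of_cw5Certificate` — the `κ = 1` row gives the square-shape
  degenerations (restrict `⟨a, B, a⟩`, `B ≥ a`, to `⟨a, a, a⟩`): for every `δ > 0` some
  `⟨M⟩ ⊗ CW_5^{⊗N}` degenerates into `⟨t⟩ ⊗ ⟨m, m, m⟩` with `M · 7^N ≤ t · m^{2.371552+δ}` — exactly the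
  hypothesis of the square assembly — so the tree keeps a SINGLE VXXZ 2024 trust base for
  `ω ≤ 2.371552`, in hypothesis form: `vxxz2024_omega_le_of_cw5Certificate` (row `κ = 1` directly) and
  `vxxz2024_omega_le_of_cw5Certificate_square` (through `omega_le_of_forall_polyDegeneratesTo`).  This
  square-shape statement was for a while the separate named fact `vxxz2024_algorithm_output`
  (`VXXZ2024AlgorithmOutput.lean`, 2026-08-15); it was merged back here (D-0026 split review): it is
  the `κ = 1` row of the certificate — the bound `ω ≤ 2.371552` minus the proved classical
  layer — not a separately printed result, and its discharge is the whole of layers (T)+(C) below.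
  Likewise the bound itself, formerly the named fact `vxxz2024_omega_le : Prop := omega ℂ ≤ 2.371552`
  of `RectangularExponent.lean`, was merged back into the table facts (second split review,
  2026-08-15): the theorems below keep its name and conclude `omega ℂ ≤ 2.371552` inline.

## What the published artifact supports, row by row

`CW5DegenerationCertificate vxxz2024TableCertified` is the statement that the laser method of
§4–§7, run with the published parameter vector of a row, outputs the degenerations whose counts the
authors' verifier checks (in floating point, tolerance `1.1·10⁻⁹`; see the audit in
`RectangularExponentCert.lean`), at `ω'` = the stored objective, `b` being its 6-decimal round-up.
The 22 `K` files are at the tabulated `κ`.  The `α` row is the `alpha` file, at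
`κ' = 0.321334051847 ≥ κ = 0.321334` with `ω' = 2 + 10⁻⁹ ≤ 2.000001`: its certificate serves
directly (`B ≥ a^{κ'} ≥ a^κ`).  The `μ` row `(0.527661, 2.055322)` is the `mu` file, at
`κ' = 0.527660664253 < κ` with `ω' = 1 + 2κ' = 2.055321328506`: a certificate at `κ'` is moved to
`κ` at the CERTIFICATE level by tensoring with `CW_5^{⊗N₂} ≥ ⟨1, 5^{N₂}, 1⟩` (the zero-out
`Σ_{i=1}^{5} x_i y_i z_0 ≡ ⟨1, 5, 1⟩` of `CW_5`, §3.6), `5^{N₂} ≥ a^{κ−κ'}`, which turns `⟨a, B, a⟩`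
into `⟨a, 5^{N₂} B, a⟩` with `5^{N₂} B ≥ a^κ` at exponent cost `(κ−κ')·log₅ 7 + O(1/log a) ≈ 4.06·10⁻⁷`,
inside the round-up margin `b − ω' = 6.71·10⁻⁷` (the 1-Lipschitz transfer of
`RectangularExponentCert.lean` moves only the exponent bound, not a certificate, and shrinking `a`
to `⌊B^{1/κ}⌋` would cost `≈ 1.31·10⁻⁶`, too much).  Discharging the hypothesis needs (T) formalised
and (C) an EXACT feasible point of the §8 program (the artifact meets its ~3 800 equality rows —
marginal identities and the Lagrange-multiplier conditions
`exp(λ_X(i)+λ_Y(j)+λ_Z(k)+λ_S−1) = α_max(i,j,k)` of §8 — only to `10⁻¹⁰`; the sound inequality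
replacing the latter is `maxEntropyPenalty_le`, `MaxEntropyGivenMarginals.lean`).

## Exact re-certification of layer (C) (harness evidence, 2026-08-15)

The floating-point caveat above can be removed for the authors' PROGRAM.  Durable evidence: ledger
item `wi-04482` (the cite item of these records), evidence files of 2026-08-15
`run/gate/evidence/wi-04482/20260815T0443*-{REPORT.md, report_all.json, float_feasibility_all.json,
certify.py, vxxz_eval.py, ivfixed.py, matreader.py}` — pure Python 3, no third-party packages; rerun
`python3 certify.py` (~95 s) next to the artifact `rmmcode.zip` of https://osf.io/7wgh2/ (1 300 666
bytes, sha256 `63d24c223724d92c20419d7cea332c7d24dfa8fe59e1daa98b1d620de92d0a12`, unpacked as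
`../artifact/`).  `vxxz_eval.py` is an independent port of `rmmcode/src/{evaluation,utils,
complete_split}`, validated (`float_feasibility_all.json`) by reproducing for every one of the 24
files the 6759 parameters / 2623 groups / 25 + 1514 + 2273(4) constraint rows and the maximal
violation `≤ 9.19·10⁻¹¹` (`1.00·10⁻⁹` for the `alpha` file) of the authors' `GetFeasibility`, all 25
inequality rows being tight; `ivfixed.py` is integer fixed-point interval arithmetic with 128
fractional bits, outward rounding and series `ln`/`exp` with explicit tails.  All logarithms and
entropies of the program and of the certificate are NATURAL (the authors' `Entropy()` is `e`-based).
For each row `(κ, b)` (`certify.py`, report `report_all.json` / `REPORT.md`):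
(1) the file's vector is REPAIRED into an exact rational point — every distribution group sums to 1
exactly (largest entry adjusted by `≤ 10⁻¹⁵`), region proportions symmetrised and renormalised,
`α_max := α`, `κ :=` the exact decimal of the row (the `alpha` file at the tabulated `0.321334 ≤ κ'`,
the `mu` file at its own `κ' = 4752744741813811·2⁻⁵³ = 0.52766066425278…`), `ω' := b` — after
which ALL linear equalities of the program hold with residual `0` and all boxes hold; (2) the
max-entropy penalty `(H_e(α_max) − H_e(α)) · frac` is replaced by
`(ln Σ_S e^{λ_X+λ_Y+λ_Z} − Σ_S α·(λ_X+λ_Y+λ_Z) − H_e(α)) · frac` at the file's multipliers — for ANY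
`λ` an UPPER bound of the true `P_α · frac` in nats (Gibbs; this is `ln 2 · (entropyDual − H)` of
`MaxEntropyGivenMarginals.maxEntropyPenalty_le`, which is stated in bits), the sound direction for
`num_retain ≤ num_block − penalty`, so the 1514 Lagrange equalities and `α_max` are not needed;
(3) every nonlinear quantity is evaluated in interval arithmetic at the exact point, the 10 auxiliary
"min" variables are re-solved as rationals below the certified lower bounds of their defining minima
(so their 24 defining inequalities hold by construction), and the limiting condition
`single_mat_size · b + Σ num_retain ≥ 4 ln 7` is checked in exact rational arithmetic against a
certified upper bound of `4 ln 7`.  Result: all 24 rows pass.  In EXPONENT units (final slack divided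
by `single_mat_size ∈ [1.24, 2.60]`, i.e. by how much `b` could still be lowered) the rooms are
`b − ω'_stored` to within `10⁻¹²` — the repair and the interval slop cost nothing visible — e.g.
`κ = 1`: `1.94·10⁻⁷`, `κ = 0.70`: `9.55·10⁻⁷`, `κ = 1.20`: `3.86·10⁻⁷`, `κ = 3`: `1.10·10⁻⁷` (the
minimum), `alpha` (at `κ = 0.321334`, `b = 2.000001`): `9.99·10⁻⁷`.  The `mu` file certifies at its
`κ'` both with `b = 2.055322` (room `6.72·10⁻⁷`) and with `b = 2.0553214` (row `mu7`, room
`7.15·10⁻⁸`); the passage from `(κ', 2.0553214)` to the tabulated `μ` row `(0.527661, 2.055322)` at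
the certificate level (tensoring with extra powers of `CW_5`, cost `(κ−κ')·log₅ 7 ≈ 4.06·10⁻⁷` in
exponent units, `< 2.055322 − 2.0553214 = 6·10⁻⁷`) is PROVED as
`RectangularExponentCertTransfer.cw5Certificate_mu_row'` (`CW5DegenerationCertificate.transfer`).
What this adds: modulo the correctness of the port and of the interval library, layer (C) holds
EXACTLY — an exact feasible point of the authors' constraint program (with the true `P_α`) exists for
every row of `vxxz2024TableCertified` (the `μ` row via the proved transfer) — so
`CW5DegenerationCertificate vxxz2024TableCertified` rests on layer (T) (Thms. 5.3/6.1/6.3, Cor. 4.2,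
and the authors' encoding of them as the program) alone.

## References

* V. Vassilevska Williams, Y. Xu, Z. Xu, R. Zhou, *New bounds for matrix multiplication: from alpha
  to omega*, SODA 2024, arXiv:2307.07970: §3.3 (degeneration), §3.5 Thm. 3.2, §3.6, §4.1–§4.2
  (algorithm framework and outline), Cor. 4.2 (fixing holes in interface tensors), Thm. 5.3,
  Thm. 6.1, Thm. 6.3, Thm. 7.2, §8 (optimisation problem; "The code and parameters are available at
  https://osf.io/7wgh2/"). [VassilevskaWilliamsXuXuZhou2024]
* J. Alman, R. Duan, V. Vassilevska Williams, Y. Xu, Z. Xu, R. Zhou, *More asymmetry yields faster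
  matrix multiplication*, SODA 2025, arXiv:2404.16349, §7. [AlmanDuanVassilevskaWilliamsXuXuZhou2025]
-/

noncomputable section

namespace Literature.Computability.AlgebraicComplexity

open Literature.Barriers.MatrixMultiplication

/-! ## Monotonicity of degeneration certificates in the bounds -/

/-- A `CW_5` degeneration certificate for a table `T` is one for every table `T'` whose rows
`(k, b')` are dominated by rows `(k, b)` of `T` with `b ≤ b'`: the same degenerations serve, and
`t · 7^N ≤ V · a^{b+δ} ≤ V · a^{b'+δ}` as `a ≥ 2`. [folklore] -/
theorem CW5DegenerationCertificate.mono {T T' : List (ℝ × ℝ)} (h : CW5DegenerationCertificate T)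
    (hTT' : ∀ k b' : ℝ, (k, b') ∈ T' → ∃ b : ℝ, (k, b) ∈ T ∧ b ≤ b') :
    CW5DegenerationCertificate T' := by
  intro k b' hkb' δ hδ
  obtain ⟨b, hkb, hbb'⟩ := hTT' k b' hkb'
  obtain ⟨N, t, V, a, B, hN, ht, hV, ha, haB, hdeg, hnum⟩ := h k b hkb δ hδ
  refine ⟨N, t, V, a, B, hN, ht, hV, ha, haB, hdeg, hnum.trans ?_⟩
  have ha1 : (1 : ℝ) ≤ a := by exact_mod_cast (by omega : 1 ≤ a)
  exact mul_le_mul_of_nonneg_left (Real.rpow_le_rpow_of_exponent_le ha1 (by linarith))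
    (Nat.cast_nonneg _)

/-! ## The certificate-backed 2024 table -/

/-- All exponents `κ` of the certificate-backed Table 1 are non-negative (indeed `≥ 0.321334`).
[cite: VassilevskaWilliamsXuXuZhou2024, §1.1 Table 1] -/
theorem vxxz2024TableCertified_fst_nonneg {k b : ℝ} (h : (k, b) ∈ vxxz2024TableCertified) :
    0 ≤ k := by
  simp only [vxxz2024TableCertified, List.mem_cons, Prod.mk.injEq, List.not_mem_nil, or_false] at h
  rcases h with ⟨rfl, -⟩ | ⟨rfl, -⟩ | ⟨rfl, -⟩ | ⟨rfl, -⟩ | ⟨rfl, -⟩ | ⟨rfl, -⟩ | ⟨rfl, -⟩ |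
    ⟨rfl, -⟩ | ⟨rfl, -⟩ | ⟨rfl, -⟩ | ⟨rfl, -⟩ | ⟨rfl, -⟩ | ⟨rfl, -⟩ | ⟨rfl, -⟩ | ⟨rfl, -⟩ |
    ⟨rfl, -⟩ | ⟨rfl, -⟩ | ⟨rfl, -⟩ | ⟨rfl, -⟩ | ⟨rfl, -⟩ | ⟨rfl, -⟩ | ⟨rfl, -⟩ | ⟨rfl, -⟩ |
    ⟨rfl, -⟩ <;> norm_num

/-- Every row `(κ, b')` of the certificate-backed table is dominated by the printed row `(κ, b)` of
Table 1: `b ≤ b'` (equality except `κ = 0.321334` (`2 ≤ 2.000001`), `κ = 0.70`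
(`2.153048 ≤ 2.153049`) and `κ = 1.20` (`2.535063 ≤ 2.535064`)).
[cite: VassilevskaWilliamsXuXuZhou2024, §1.1 Table 1 and §8] -/
theorem vxxz2024Table_row_le_certified {k b' : ℝ} (h : (k, b') ∈ vxxz2024TableCertified) :
    ∃ b : ℝ, (k, b) ∈ vxxz2024Table ∧ b ≤ b' := by
  simp only [vxxz2024TableCertified, List.mem_cons, Prod.mk.injEq, List.not_mem_nil, or_false] at h
  rcases h with ⟨rfl, rfl⟩ | ⟨rfl, rfl⟩ | ⟨rfl, rfl⟩ | ⟨rfl, rfl⟩ |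
    ⟨rfl, rfl⟩ | ⟨rfl, rfl⟩ | ⟨rfl, rfl⟩ | ⟨rfl, rfl⟩ |
    ⟨rfl, rfl⟩ | ⟨rfl, rfl⟩ | ⟨rfl, rfl⟩ | ⟨rfl, rfl⟩ |
    ⟨rfl, rfl⟩ | ⟨rfl, rfl⟩ | ⟨rfl, rfl⟩ | ⟨rfl, rfl⟩ |
    ⟨rfl, rfl⟩ | ⟨rfl, rfl⟩ | ⟨rfl, rfl⟩ | ⟨rfl, rfl⟩ |
    ⟨rfl, rfl⟩ | ⟨rfl, rfl⟩ | ⟨rfl, rfl⟩ | ⟨rfl, rfl⟩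
  · exact ⟨2, by norm_num [vxxz2024Table], by norm_num⟩          -- α row: printed 2
  · exact ⟨2.000100, by norm_num [vxxz2024Table], le_rfl⟩
  · exact ⟨2.000600, by norm_num [vxxz2024Table], le_rfl⟩
  · exact ⟨2.001363, by norm_num [vxxz2024Table], le_rfl⟩
  · exact ⟨2.009541, by norm_num [vxxz2024Table], le_rfl⟩
  · exact ⟨2.023788, by norm_num [vxxz2024Table], le_rfl⟩
  · exact ⟨2.042994, by norm_num [vxxz2024Table], le_rfl⟩
  · exact ⟨2.055322, by norm_num [vxxz2024Table], le_rfl⟩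
  · exact ⟨2.066134, by norm_num [vxxz2024Table], le_rfl⟩
  · exact ⟨2.092631, by norm_num [vxxz2024Table], le_rfl⟩
  · exact ⟨2.121734, by norm_num [vxxz2024Table], le_rfl⟩
  · exact ⟨2.153048, by norm_num [vxxz2024Table], by norm_num⟩   -- κ = 0.70: printed 2.153048
  · exact ⟨2.186210, by norm_num [vxxz2024Table], le_rfl⟩
  · exact ⟨2.220929, by norm_num [vxxz2024Table], le_rfl⟩
  · exact ⟨2.256984, by norm_num [vxxz2024Table], le_rfl⟩
  · exact ⟨2.294209, by norm_num [vxxz2024Table], le_rfl⟩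
  · exact ⟨2.332440, by norm_num [vxxz2024Table], le_rfl⟩
  · exact ⟨2.371552, by norm_num [vxxz2024Table], le_rfl⟩
  · exact ⟨2.452056, by norm_num [vxxz2024Table], le_rfl⟩
  · exact ⟨2.535063, by norm_num [vxxz2024Table], by norm_num⟩   -- κ = 1.20: printed 2.535063
  · exact ⟨2.794941, by norm_num [vxxz2024Table], le_rfl⟩
  · exact ⟨3.250385, by norm_num [vxxz2024Table], le_rfl⟩
  · exact ⟨3.720468, by norm_num [vxxz2024Table], le_rfl⟩
  · exact ⟨4.198809, by norm_num [vxxz2024Table], le_rfl⟩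

/-- **The certificate-backed Table 1 of VXXZ 2024 from a laser-method degeneration certificate**:
layers 1–2 of the printed proof (`R̃(CW_5) ≤ 7`, Schönhage's rectangular asymptotic sum inequality,
Thm. 3.2) are theorems of the tree, so `vxxz2024_omegaRect_table_certified` follows from a `CW_5`
degeneration certificate for its table (layers (T)+(C) of §4–§8, see the module docstring) alone.
[cite: VassilevskaWilliamsXuXuZhou2024, §4.1 and §8] -/
theorem vxxz2024_omegaRect_table_certified_of_cw5Certificate
    (h : CW5DegenerationCertificate vxxz2024TableCertified) : vxxz2024_omegaRect_table_certified :=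
  fun _ _ hkb => omegaRect_le_of_cw5DegenerationCertificate h hkb (vxxz2024TableCertified_fst_nonneg hkb)

/-- All exponents `κ` of the printed Table 1 are non-negative. [cite: VassilevskaWilliamsXuXuZhou2024, §1.1 Table 1] -/
theorem vxxz2024Table_fst_nonneg {k b : ℝ} (h : (k, b) ∈ vxxz2024Table) : 0 ≤ k := by
  simp only [vxxz2024Table, List.mem_cons, Prod.mk.injEq, List.not_mem_nil, or_false] at h
  rcases h with ⟨rfl, -⟩ | ⟨rfl, -⟩ | ⟨rfl, -⟩ | ⟨rfl, -⟩ | ⟨rfl, -⟩ | ⟨rfl, -⟩ | ⟨rfl, -⟩ |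
    ⟨rfl, -⟩ | ⟨rfl, -⟩ | ⟨rfl, -⟩ | ⟨rfl, -⟩ | ⟨rfl, -⟩ | ⟨rfl, -⟩ | ⟨rfl, -⟩ | ⟨rfl, -⟩ |
    ⟨rfl, -⟩ | ⟨rfl, -⟩ | ⟨rfl, -⟩ | ⟨rfl, -⟩ | ⟨rfl, -⟩ | ⟨rfl, -⟩ | ⟨rfl, -⟩ | ⟨rfl, -⟩ |
    ⟨rfl, -⟩ <;> norm_num

/-- Likewise the PRINTED Table 1 (`vxxz2024_omegaRect_table`, including `ω ≤ 2.371552`,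
`ω(1, 0.321334, 1) ≤ 2`, `μ ≤ 0.527661`) follows from a degeneration certificate for the printed
table. [cite: VassilevskaWilliamsXuXuZhou2024, §4.1 and §8] -/
theorem vxxz2024_omegaRect_table_of_cw5Certificate (h : CW5DegenerationCertificate vxxz2024Table) :
    vxxz2024_omegaRect_table :=
  fun _ _ hkb => omegaRect_le_of_cw5DegenerationCertificate h hkb (vxxz2024Table_fst_nonneg hkb)

/-- A degeneration certificate for the PRINTED Table 1 implies one for the certificate-backed
table, row by row (`vxxz2024Table_row_le_certified`): the latter is the weaker statement.
[cite: VassilevskaWilliamsXuXuZhou2024, §1.1 Table 1 and §8] -/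
theorem cw5Certificate_vxxz2024TableCertified_of_printed (h : CW5DegenerationCertificate vxxz2024Table) :
    CW5DegenerationCertificate vxxz2024TableCertified :=
  h.mono fun _ _ hkb' => vxxz2024Table_row_le_certified hkb'

/-! ## The square-shape degenerations (`κ = 1`) and `ω ≤ 2.371552` -/

/-- **One trust base**: the `κ = 1` row `(1, 2.371552)` of a certificate for the certificate-backed
table yields the square-shape degenerations consumed by the assembly lemma
`omega_le_of_forall_polyDegeneratesTo` (`LaserDegenerationBound.lean`): for every `δ > 0` some
`⟨M⟩ ⊗ CW_5^{⊗N}` degenerates into `⟨t⟩ ⊗ ⟨m, m, m⟩` (`t ≥ 1`, `m ≥ 2`) with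
`M · 7^N ≤ t · m^{2.371552+δ}` — restrict `⟨a, B, a⟩` with `B ≥ a^1 = a` to `⟨a, a, a⟩` (zero-padding,
`tensorRestrictsTo_matMulTensor_of_le`) inside `⟨V⟩ ⊗ ·`, and compose the degeneration with this
restriction (§8: the constraint `numgrow^{1/n} · min{A, B^{1/κ}, C}^{ω'/n} ≥ (q+2)^{2^{l*-1}}` accounts
for the output `⟨A, B, C⟩` through its smallest side).  Formerly the named fact
`vxxz2024_algorithm_output`, merged back into this hypothesis form (see the module docstring).
[cite: VassilevskaWilliamsXuXuZhou2024, §8] -/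
theorem forall_polyDegeneratesTo_square_of_cw5Certificate
    (h : CW5DegenerationCertificate vxxz2024TableCertified) :
    ∀ δ : ℝ, 0 < δ → ∃ t m M N : ℕ, 1 ≤ t ∧ 2 ≤ m ∧
      PolyDegeneratesTo (kroneckerTensor (unitTensor ℂ M) (kroneckerPow (bigCwTensor ℂ 5) N))
        (kroneckerTensor (unitTensor ℂ t) (matMulTensor ℂ m m m)) ∧
      (M : ℝ) * 7 ^ N ≤ (t : ℝ) * (m : ℝ) ^ ((2.371552 : ℝ) + δ) := by
  intro δ hδ
  obtain ⟨N, t, V, a, B, -, -, hV, ha, haB, hdeg, hnum⟩ :=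
    h 1 2.371552 (by norm_num [vxxz2024TableCertified]) δ hδ
  have haB' : a ≤ B := by
    rw [Real.rpow_one] at haB
    exact_mod_cast haB
  refine ⟨V, a, t, N, hV, ha, hdeg.trans_restrictsTo ?_, hnum⟩
  classical
  exact (TensorRestrictsTo.refl (unitTensor ℂ V)).kronecker
    (tensorRestrictsTo_matMulTensor_of_le ℂ le_rfl haB' le_rfl)

/-- Hence a certificate for the certificate-backed table gives `ω ≤ 2.371552` directly, as row
`κ = 1` (`vxxz2024_omegaRect_table_certified.omega_le`).  Stated inline: the former named fact
`vxxz2024_omega_le : Prop := omega ℂ ≤ 2.371552` (whose name these theorems keep) was merged back into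
the table facts by the D-0026 split review of 2026-08-15 — it is this row, not a separately proved
result. [cite: VassilevskaWilliamsXuXuZhou2024, §8] -/
theorem vxxz2024_omega_le_of_cw5Certificate (h : CW5DegenerationCertificate vxxz2024TableCertified) :
    omega ℂ ≤ 2.371552 :=
  (vxxz2024_omegaRect_table_certified_of_cw5Certificate h).omega_le

/-- … and equally through the square route: the `κ = 1` degenerations
(`forall_polyDegeneratesTo_square_of_cw5Certificate`) fed to the proved assembly
`omega_le_of_forall_polyDegeneratesTo` (Schönhage's asymptotic sum inequality and `R̃(CW_5) ≤ 7`),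
with `(5 : ℝ) + 2 = 7`. [cite: VassilevskaWilliamsXuXuZhou2024, §8] -/
theorem vxxz2024_omega_le_of_cw5Certificate_square
    (h : CW5DegenerationCertificate vxxz2024TableCertified) : omega ℂ ≤ 2.371552 := by
  refine omega_le_of_forall_polyDegeneratesTo ℂ (q := 5) fun δ hδ => ?_
  obtain ⟨t, m, M, N, ht, hm, hdeg, hcount⟩ :=
    forall_polyDegeneratesTo_square_of_cw5Certificate h δ hδ
  refine ⟨t, m, M, N, ht, hm, hdeg, ?_⟩
  have h7 : ((5 : ℕ) : ℝ) + 2 = 7 := by norm_num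
  rw [h7]
  exact hcount

end Literature.Computability.AlgebraicComplexity

end
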